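import Summits.BirchSwinnertonDyer.BirchSwinnertonDyer.Theorems.SignedLowerHalvesSmallImageLowerHalfBothSignsRttCharRoadE2OLinear
import Literature.NumberTheory.EllipticCurves.IwasawaSelmerDualFunctorialityProofs
import HarnessLib

/-!
# Route `SignedLowerHalves`, crux L `SmallImageLowerHalfBothSigns` (stmt-BirchSwinnertonDyer-23599), line `rtt_w3` v13 — E2, row D2-seq (1′) `gX`, LEAD:
# THE TRANSPOSE OF AN EQUIVARIANT MAP OF DISCRETE MODULES IS `Λ_𝒪`-LINEAR ON THE PONTRYAGIN DUALS

WHY (BRIEF-E2 rev 3.1 §2 row `gX := loc_v^∨`, `Lines/rtt_w3-BRIEF-E2-g9b.md`). In Kobayashi's architecture the map `gX : Q → X'` of `charRoad_E2_of_localisation`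
(p776213) is the TRANSPOSE of the localisation `loc_v : Sel → E` through the Pontryagin dualities `toDual_Q : Q ≅ Hom(E, ℚ/ℤ)`, `toDual : X' = Dψ.X ≅ Hom(Sel, ℚ/ℤ)` —
the tree's `IwasawaDual.dualHom`, which is `Λ = ℤ_p⟦T⟧`-linear when `loc_v` intertwines the operators `ψ = conj_γ − 1` (`IwasawaDual.dualHom_smul`). The glue needs
`Λ_𝒪`-linearity for the `Λ_𝒪 = 𝒪⟦T⟧`-structures of `…RttCharRoadE2DualOStructure` (`(ι f)•x = f•x`, `toDual ((C a)•x) = toDual x ∘ σ a`). This file proves it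
abstractly (`dualHom_smul_iwasawaAlgebraO`): for two unbundled dual data with such `Λ_𝒪`-structures and an additive `Φ : S₁ → S₂` commuting with the `ψ`'s AND with
the scalar actions `σᵢ a`, `dualHom Φ (F • x) = F • dualHom Φ x` for every `F ∈ Λ_𝒪` (`…RttCharRoadE2OLinear.map_smul_of_commute_C_iwasawaToIwasawaO`).
THEOREMS ONLY; nothing about E2 itself is proved. [cite: GreenbergLNM1716, §1 (after Conj. 1.3)] [cite: Washington1997, §13.2] [folklore]
-/

set_option linter.dupNamespace false -- D-0017: single-problem summit, the namespace repeats the problem name by design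
set_option autoImplicit false

noncomputable section

namespace Summit.BirchSwinnertonDyer.BirchSwinnertonDyer.Theorems.SmallImageRttCharRoad

open PowerSeries Literature.NumberTheory.EllipticCurves Literature.NumberTheory.EllipticCurves.IwasawaDual

universe u v w x

variable {p : ℕ} [Fact p.Prime] (S : Set (PadicAlgCl p)) [FiniteDimensional ℚ_[p] (padicCoeffField S)]

/-- **The transpose `Φ^∨ = IwasawaDual.dualHom` is `Λ_𝒪`-linear.** Data: abelian groups `S₁, S₂` with locally nilpotent `ψᵢ` (`IsLocNil p ψᵢ`) and scalar maps
`σᵢ : 𝒪 → End(Sᵢ)`; `Λ_𝒪`-modules `X₁, X₂` that are also `Λ`-modules, with additive `toDualᵢ : Xᵢ → Hom(Sᵢ, ℚ/ℤ)` (`toDual₁` bijective) such that (a) the `Λ`-action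
read through `toDualᵢ` is the canonical `smulFun` of `ψᵢ`, (b) `(iwasawaToIwasawaO S f) • x = f • x`, (c) `toDualᵢ ((C a) • x) = toDualᵢ x ∘ σᵢ a`; and an additive
`Φ : S₁ → S₂` with `Φ ∘ ψ₁ = ψ₂ ∘ Φ` and `Φ ∘ σ₁ a = σ₂ a ∘ Φ`. Then `dualHom Φ (F • x) = F • dualHom Φ x` for all `F ∈ Λ_𝒪`. [cite: GreenbergLNM1716, §1 (after Conj. 1.3)] -/
theorem dualHom_smul_iwasawaAlgebraO {S₁ : Type u} {S₂ : Type v} [AddCommGroup S₁] [AddCommGroup S₂]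
    {X₁ : Type w} [AddCommGroup X₁] {X₂ : Type x} [AddCommGroup X₂]
    [Module (IwasawaAlgebra p) X₁] [Module (IwasawaAlgebra p) X₂] [Module (IwasawaAlgebraO S) X₁] [Module (IwasawaAlgebraO S) X₂]
    (toDual₁ : X₁ →+ (S₁ →+ AddCircle (1 : ℚ))) (hbij₁ : Function.Bijective toDual₁)
    (toDual₂ : X₂ →+ (S₂ →+ AddCircle (1 : ℚ))) (Φ : S₁ →+ S₂)
    {ψ₁ : AddMonoid.End S₁} {ψ₂ : AddMonoid.End S₂} (h₁ : IsLocNil p ψ₁) (h₂ : IsLocNil p ψ₂)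
    (hsmul₁ : ∀ (f : IwasawaAlgebra p) (x : X₁), toDual₁ (f • x) = h₁.smulFun f (toDual₁ x))
    (hsmul₂ : ∀ (f : IwasawaAlgebra p) (x : X₂), toDual₂ (f • x) = h₂.smulFun f (toDual₂ x))
    (hι₁ : ∀ (f : IwasawaAlgebra p) (x : X₁), iwasawaToIwasawaO S f • x = f • x)
    (hι₂ : ∀ (f : IwasawaAlgebra p) (x : X₂), iwasawaToIwasawaO S f • x = f • x)
    (σ₁ : padicCoeffIntegers S → (S₁ →+ S₁)) (σ₂ : padicCoeffIntegers S → (S₂ →+ S₂))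
    (hC₁ : ∀ (a : padicCoeffIntegers S) (x : X₁) (s : S₁), toDual₁ ((PowerSeries.C a : IwasawaAlgebraO S) • x) s = toDual₁ x (σ₁ a s))
    (hC₂ : ∀ (a : padicCoeffIntegers S) (x : X₂) (s : S₂), toDual₂ ((PowerSeries.C a : IwasawaAlgebraO S) • x) s = toDual₂ x (σ₂ a s))
    (hΦψ : ∀ s, Φ (ψ₁ s) = ψ₂ (Φ s)) (hΦσ : ∀ (a : padicCoeffIntegers S) (s : S₁), Φ (σ₁ a s) = σ₂ a (Φ s))
    (F : IwasawaAlgebraO S) (x : X₂) :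
    dualHom toDual₁ hbij₁ toDual₂ Φ (F • x) = F • dualHom toDual₁ hbij₁ toDual₂ Φ x := by
  refine map_smul_of_commute_C_iwasawaToIwasawaO S (dualHom toDual₁ hbij₁ toDual₂ Φ) (fun r y ↦ ?_) (fun a y ↦ ?_) F x
  · -- `Λ`-linearity: the tree's `dualHom_smul`, moved along `(ι f)• = f•`
    rw [hι₂, hι₁]
    exact dualHom_smul toDual₁ hbij₁ toDual₂ Φ h₁ h₂ hsmul₁ hsmul₂ hΦψ r y
  · -- the constants `C a`: both transposes read through `toDual`
    apply hbij₁.1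
    ext s
    rw [toDual_dualHom_apply, hC₂, hC₁, toDual_dualHom_apply, hΦσ]

end Summit.BirchSwinnertonDyer.BirchSwinnertonDyer.Theorems.SmallImageRttCharRoad

end
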